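import Mathlib.Topology.Algebra.Group.Basic
import Mathlib.Topology.OpenPartialHomeomorph.Constructions
import Mathlib.Tactic.Group
import HarnessLib

/-!
# Re-basing a torus-coordinate chart datum so that the section is `1` at the base point (generic topological-group plumbing)
# (Harish-Chandra 1970 Part I §3 «chart `e(a,t) = s(a)·t·s(a)⁻¹`»; Rogawski 1990 §4.3)

Topic `NumberTheory/Automorphic` (generic layer, next to ★ `ChartDatumProdTransport`); namespace `Literature.NumberTheory.Automorphic`.  ONE THEOREM (no definition, no instance,
no notation, no named fact, no `sorry`).  Cell `pub/hodgecm-mathlib` (D-0151), crux H413 = stmt-HodgeConjecture-24833, floor-2 line «N6nsGerm» (S2 junction); seat F0P2-p02 (g8).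
WHY.  The torus–singular junction ★ `exists_nhds_stableOrbitalIntegralRel_eq_of_torus_singular_inv` (p841663) consumes an `H_v`-chart `e(a, t) = s(a)·t·s(a)⁻¹` in the
coordinates of `T = Z_H(ε_H)` WITH `s a₀ = 1` (so that `e(a₀, b₀) = ε_H`), while the chart producer ★ `exists_chartDatum_H_local_centralizer_of_isRegularElt_fst` (A-p16 (g26),
p841509) only promises `(a₀, t₀) ∈ e.source`, `↑t₀ = ε_H`.  Conjugating by `c := s a₀` re-bases: `s′ := c⁻¹·s`, `e′ := c⁻¹·e·c` has `s′ a₀ = 1`, the same source, the same boxes,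
and the shrinking clause (compact∕open boxes, abstract per-point clause `R t`, SATURATION «`x·t·x⁻¹ ∈ e′(K × B₁) ⇒ x ∈ s′(K)·T`», abstract separation `st`) transports verbatim.
HONEST LABEL: plumbing only; HC_CM is proved only modulo the printed citations until rung 0 closes.

## References
* [HarishChandra1970] Harish-Chandra (notes by G. van Dijk), *Harmonic Analysis on Reductive p-adic Groups*, LNM 162 (1970): Part I §3.
* [Rogawski1990] J. Rogawski, *Automorphic Representations of Unitary Groups in Three Variables*, Ann. of Math. Stud. 123 (1990): §4.3 (4.3.1) p. 43.
-/

set_option autoImplicit false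

noncomputable section

open Set Filter Topology
open scoped Pointwise

namespace Literature.NumberTheory.Automorphic

section Rebase

variable {G : Type*} [Group G] [TopologicalSpace G] [IsTopologicalGroup G] {A : Type*} [TopologicalSpace A]

/-- **RE-BASING A TORUS-COORDINATE CHART DATUM AT THE BASE POINT.**  Given a chart `e : A × T → G`, `e(a, t) = s(a)·t·s(a)⁻¹` on its source, continuous `s`, a base point
`(a₀, b₀) ∈ e.source`, and the shrinking clause (for every neighbourhood `N` of the base point: compact open boxes `K ∋ a₀`, `B₁ ∋ b₀` with `K × B₁ ⊆ N ∩ e.source`, an abstract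
per-point clause `R` on `B₁`, SATURATION w.r.t. `s(K)·T`, and separation of `B₁` by an abstract relation `st`), the conjugated datum `s′ a := (s a₀)⁻¹ * s a`,
`e′ := (s a₀)⁻¹ · e · (s a₀)` satisfies the same with `s′ a₀ = 1` — so `e′(a₀, b₀) = b₀`. [cite: HarishChandra1970, Part I §3] [cite: Rogawski1990, §4.3 (4.3.1) p. 43] -/
theorem exists_chartDatum_rebase_section_eq_one (T : Subgroup G) (s : A → G) (hs : Continuous s) (e : OpenPartialHomeomorph (A × ↥T) G)
    (a₀ : A) (b₀ : ↥T) (he : ∀ p ∈ e.source, e p = s p.1 * (p.2 : G) * (s p.1)⁻¹) (h₀ : (a₀, b₀) ∈ e.source)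
    (R : ↥T → Prop) (st : G → G → Prop)
    (hN : ∀ N ∈ 𝓝 (a₀, b₀), ∃ (K : Set A) (B₁ : Set ↥T), IsCompact K ∧ IsOpen K ∧ a₀ ∈ K ∧ IsCompact B₁ ∧ IsOpen B₁ ∧ b₀ ∈ B₁ ∧
      K ×ˢ B₁ ⊆ N ∧ K ×ˢ B₁ ⊆ e.source ∧ (∀ t ∈ B₁, R t) ∧
      (∀ t ∈ B₁, ∀ x : G, x * (t : G) * x⁻¹ ∈ e '' (K ×ˢ B₁) → x ∈ s '' K * (T : Set G)) ∧
      (∀ t ∈ B₁, ∀ t' ∈ B₁, st (t : G) (t' : G) → t = t')) :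
    ∃ (s' : A → G) (e' : OpenPartialHomeomorph (A × ↥T) G), Continuous s' ∧ s' a₀ = 1 ∧
      (∀ p ∈ e'.source, e' p = s' p.1 * (p.2 : G) * (s' p.1)⁻¹) ∧ (a₀, b₀) ∈ e'.source ∧ e' (a₀, b₀) = (b₀ : G) ∧
      ∀ N ∈ 𝓝 (a₀, b₀), ∃ (K : Set A) (B₁ : Set ↥T), IsCompact K ∧ IsOpen K ∧ a₀ ∈ K ∧ IsCompact B₁ ∧ IsOpen B₁ ∧ b₀ ∈ B₁ ∧
        K ×ˢ B₁ ⊆ N ∧ K ×ˢ B₁ ⊆ e'.source ∧ (∀ t ∈ B₁, R t) ∧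
        (∀ t ∈ B₁, ∀ x : G, x * (t : G) * x⁻¹ ∈ e' '' (K ×ˢ B₁) → x ∈ s' '' K * (T : Set G)) ∧
        (∀ t ∈ B₁, ∀ t' ∈ B₁, st (t : G) (t' : G) → t = t') := by
  set c : G := s a₀ with hc
  -- conjugation by `c⁻¹` as a homeomorphism `y ↦ c⁻¹ * y * c`
  let κ : G ≃ₜ G := (Homeomorph.mulLeft c⁻¹).trans (Homeomorph.mulRight c)
  have hκ : ∀ y : G, κ y = c⁻¹ * y * c := fun y => rfl
  refine ⟨fun a => c⁻¹ * s a, e.transHomeomorph κ, (continuous_const.mul hs), by simp only [hc, inv_mul_cancel], ?_, ?_, ?_, ?_⟩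
  · intro p hp
    rw [OpenPartialHomeomorph.transHomeomorph_source] at hp
    rw [OpenPartialHomeomorph.transHomeomorph_apply, Function.comp_apply, hκ, he p hp]
    group
  · rw [OpenPartialHomeomorph.transHomeomorph_source]; exact h₀
  · rw [OpenPartialHomeomorph.transHomeomorph_apply, Function.comp_apply, hκ, he _ h₀]
    simp only [hc]
    group
  · intro N hN'
    obtain ⟨K, B₁, hKc, hKo, haK, hB₁c, hB₁o, hbB, hNB, hKB, hR, hsat, hsep⟩ := hN N hN'
    refine ⟨K, B₁, hKc, hKo, haK, hB₁c, hB₁o, hbB, hNB, by rw [OpenPartialHomeomorph.transHomeomorph_source]; exact hKB, hR, ?_, hsep⟩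
    intro t ht x hx
    -- `x t x⁻¹ = c⁻¹ · e p · c` for some `p ∈ K × B₁`, so `(c x) t (c x)⁻¹ ∈ e(K × B₁)`
    obtain ⟨p, hp, hpx⟩ := hx
    rw [OpenPartialHomeomorph.transHomeomorph_apply, Function.comp_apply, hκ] at hpx
    have hx' : c * x * (t : G) * (c * x)⁻¹ ∈ e '' (K ×ˢ B₁) := by
      refine ⟨p, hp, ?_⟩
      rw [mul_inv_rev, ← mul_assoc, mul_assoc (c * x), mul_assoc c, ← mul_assoc x, ← hpx]
      group
    obtain ⟨y, hy, z, hz, hyz⟩ := Set.mem_mul.1 (hsat t ht (c * x) (by simpa [mul_assoc] using hx'))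
    obtain ⟨a, haK', rfl⟩ := hy
    refine Set.mem_mul.2 ⟨c⁻¹ * s a, ⟨a, haK', rfl⟩, z, hz, ?_⟩
    rw [mul_assoc, hyz, ← mul_assoc, inv_mul_cancel, one_mul]

end Rebase

end Literature.NumberTheory.Automorphic

end
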